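import Mathlib
import Literature.NumberTheory.Automorphic.LocalWeylLaw

/-!
# Regularity of invariant integral operators: Lemma 1.8, Theorem 1.9 and the regularity criterion
(Iwaniec, *Spectral Methods of Automorphic Forms*, GSM 53, §1.6 (1.20)–(1.21), §1.8 Lemma 1.8,
Theorems 1.9, 1.15, 1.16, PDF pp. 16, 21–24)

Fifteenth layer of the `provefact` decomposition of `Literature.NumberTheory.Automorphic.sl2BallCount_asymp`
(`HyperbolicLatticeCount.lean`), sixth brick of the spectral theory of `L²(SL₂(ℤ)\\ℍ)` behind
`Iwaniec2002_thm_7_4_modular` (`ModularPretrace.lean`). The eigenfunctions entering Theorem 7.4 —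
Eisenstein series and Maass cusp forms — are produced as eigenfunctions of the invariant integral
operators `L_k`; that they are then genuine `C²` eigenfunctions of `Δ` is the content of Theorems 1.9
and 1.15, proved here in the form needed. Everything here is proved; nothing is vendored.

1. **Lemma 1.8** (`hypLaplacian_radial_kernel`): for `k ∈ C²(ℝ)` with derivatives `k'`, `k''`,
   `Δ_z k(u(z, w)) = k_Δ(u(z, w))`, `k_Δ(u) = u(u+1) k''(u) + (2u+1) k'(u)` (`kernelLaplacian`) —
   about `i` by geodesic polar coordinates and (1.20) (`polarLaplacian_identity`,
   `InvariantOperatorEigenfunctions.lean`), at `i` by continuity, in general by transitivity of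
   `SL₂(ℝ)` and invariance of `Δ` (`InvariantLaplacian.lean`).
2. `D²F(p)[v, v]` through slices `t ↦ F(p + tv)` (`fderiv_fderiv_apply_eq_of_slice`).
3. **Theorem 1.9, kernel form** (`isC2_invariantOperator_and_hypLaplacian`): for a test kernel
   `k ∈ C²` and `f ∈ L¹_loc(ℍ)`, `L_k f ∈ C²(ℍ)` and `Δ(L_k f) = L_{k_Δ} f` — two differentiations
   under the integral sign (`hasFDerivAt_integral_of_dominated_of_fderiv_le`) with the joint kernel
   `kJoint` on `ℂ × ℂ`, its partial derivatives `pD1`, uniform compact support of the kernel for the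
   parameter in a Euclidean disc (`far_of_not_mem_ball`), and `C²` regularity through
   `contDiffOn_clm_apply`.
4. `h_{k_Δ}(t) = -(1/4 + t²) h_k(t)` (`selbergTransform_kernelLaplacian`; Theorem 1.9 with
   Theorem 1.16 on `y^s`), `k_Δ` being a test kernel after truncation to `u ≥ 0` (`truncKernel`);
   a smooth non-negative test kernel with `h(t) ≠ 0` for any `t` (`exists_smooth_testKernel`, by the
   estimate of the proof of Proposition 7.2 for small discs, `LocalWeylLaw.lean`); and the
   **regularity criterion** (`isC2_and_eigen_of_invariantOperator`; Theorem 1.15 flavour): a locally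
   integrable `f` with `L_k f = h_k(t) f` for all test kernels `k` is `C²` with `(Δ + 1/4 + t²) f = 0`.

Mathlib: `hasFDerivAt_integral_of_dominated_of_fderiv_le`, `continuousAt_of_dominated`,
`contDiffOn_clm_apply`, `contDiffOn_succ_iff_fderiv_of_isOpen`, `ContinuousLinearMap.integral_apply`,
`ContDiffBump`, `InnerProductSpace.laplacian_smul`. (The second partial derivative is kept scalar,
`pD1` of `q ↦ D(kJoint)(q)[(v,0)]`, because the norm topology on the iterated space
`ℂ →L[ℝ] (ℂ →L[ℝ] ℂ)` is not definitionally its operator topology in Mathlib, which blocks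
`IsCompact.exists_bound_of_continuousOn` there.)
-/

noncomputable section

namespace Literature.NumberTheory.Automorphic

open MeasureTheory Set Filter Real UpperHalfPlane InnerProductSpace Laplacian
open scoped Topology MatrixGroups

/-! ## 1. Second derivatives along lines -/

/-- The line `t ↦ p + t v` has velocity `v`. [folklore] -/
theorem hasDerivAt_line (p v : ℂ) (t : ℝ) : HasDerivAt (fun t : ℝ => p + (t : ℂ) * v) v t := by
  have h : HasDerivAt (fun t : ℝ => (t : ℂ)) 1 t := by simpa using (hasDerivAt_id t).ofReal_comp
  simpa using (h.mul_const v).const_add p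

/-- **`D²F(p)[v, v]` is the second derivative of the slice `t ↦ F(p + tv)` at `t = 0`**: if the slice
has derivative `σ₁` near `0` and `σ₁` has derivative `S₂` at `0`, then `D²F(p)[v,v] = S₂`, for `F` of
class `C²` near `p`. [folklore] -/
theorem fderiv_fderiv_apply_eq_of_slice {F : ℂ → ℂ} {U : Set ℂ} (hU : IsOpen U) (hF : ContDiffOn ℝ 2 F U)
    {p v : ℂ} (hp : p ∈ U) {σ₁ : ℝ → ℂ} {S₂ : ℂ}
    (h1 : ∀ᶠ t : ℝ in 𝓝 0, HasDerivAt (fun t : ℝ => F (p + (t : ℂ) * v)) (σ₁ t) t)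
    (h2 : HasDerivAt σ₁ S₂ 0) :
    fderiv ℝ (fderiv ℝ F) p v v = S₂ := by
  -- the slice derivative is `t ↦ DF(p + tv)[v]` near 0
  have hnear : ∀ᶠ t : ℝ in 𝓝 0, p + (t : ℂ) * v ∈ U := by
    have hc : Continuous fun t : ℝ => p + (t : ℂ) * v := by fun_prop
    have : p + ((0 : ℝ) : ℂ) * v ∈ U := by simpa using hp
    exact hc.continuousAt.preimage_mem_nhds (hU.mem_nhds this)
  have heq : σ₁ =ᶠ[𝓝 0] fun t => fderiv ℝ F (p + (t : ℂ) * v) v := by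
    filter_upwards [h1, hnear] with t ht htU
    exact ht.unique (hasDerivAt_comp_curve hU hF htU (hasDerivAt_line p v t))
  have h3 : HasDerivAt (fun t : ℝ => fderiv ℝ F (p + (t : ℂ) * v) v)
      (fderiv ℝ (fderiv ℝ F) p v v) 0 := by
    have := hasDerivAt_fderiv_comp_apply hU hF (c := fun t : ℝ => p + (t : ℂ) * v) (u := fun _ => v)
      (t₀ := 0) (a := 0) (by simpa using hp) (by simpa using hasDerivAt_line p v 0) (hasDerivAt_const 0 v)
    simpa using this
  exact h3.unique (h2.congr_of_eventuallyEq heq.symm)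


/-! ## Lemma 1.8: `Δ_z k(u(z, w)) = u(u+1) k''(u) + (2u+1) k'(u)` -/

section Lemma18

variable {k k' k'' : ℝ → ℝ}

/-- The radial derivative profile `k_Δ(u) = u(u+1) k''(u) + (2u+1) k'(u)` of Lemma 1.8 / (1.21).
[cite: Iwaniec2002, Lemma 1.8 & (1.21), PDF pp. 16, 21] -/
def kernelLaplacian (k' k'' : ℝ → ℝ) (u : ℝ) : ℝ := u * (u + 1) * k'' u + (2 * u + 1) * k' u

/-- The algebra of Lemma 1.8. [folklore] -/
theorem alg18 (kp kpp S C u s c : ℂ) (hS : S = 2 * s * c) (hC : C = 1 + 2 * u) (hc : c ^ 2 = 1 + u) (hu : u = s ^ 2) :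
    (u * (u + 1) * kpp + (2 * u + 1) * kp) * S = C * (kp * (S / 2)) + S * (kpp * (S / 2) ^ 2 + kp * (C / 2)) := by
  rw [hS, hC]
  linear_combination (-2 * s ^ 3 * c * kpp) * hc + (2 * s * c * kpp * (1 + u)) * hu

/-- Rotations about `i` do not change `k(u(z, i))`. [folklore] -/
theorem radial_kernel_rot (k : ℝ → ℝ) (θ : ℝ) (z : ℍ) :
    k (pointPairInv (rot θ • z) UpperHalfPlane.I) = k (pointPairInv z UpperHalfPlane.I) := by
  conv_lhs => rw [← rot_smul_I θ, pointPairInv_smul]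

/-- `u(i e^r, i) = sinh²(r/2)`. [cite: Iwaniec2002, (1.3)–(1.4), PDF p. 9] -/
theorem pointPairInv_axisPt_I (r : ℝ) : pointPairInv (axisPt r) UpperHalfPlane.I = Real.sinh (r / 2) ^ 2 := by
  rw [pointPairInv_eq_coord, axisPt_re, axisPt_im, UpperHalfPlane.I_re, UpperHalfPlane.I_im]
  have h := expSubst_arg (y₀ := 1) one_pos r
  rw [← h]
  ring

/-- The polar profile of the radial kernel: `g(r, φ) = k(sinh²(r/2))`. [folklore] -/
theorem polarFn_radial_kernel (k : ℝ → ℝ) (q : ℝ × ℝ) :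
    polarFn (fun z : ℍ => (k (pointPairInv z UpperHalfPlane.I) : ℂ)) q = (k (Real.sinh (q.1 / 2) ^ 2) : ℂ) := by
  simp only [polarFn, radial_kernel_rot, pointPairInv_axisPt_I]

/-- `d/dr sinh²(r/2) = sinh r / 2`. [folklore] -/
theorem hasDerivAt_sinh_sq_half (r : ℝ) :
    HasDerivAt (fun r : ℝ => Real.sinh (r / 2) ^ 2) (Real.sinh r / 2) r := by
  have h1 : HasDerivAt (fun r : ℝ => r / 2) (1 / 2) r := (hasDerivAt_id r).div_const 2
  have h2 : HasDerivAt (fun r : ℝ => Real.sinh (r / 2)) (Real.cosh (r / 2) * (1 / 2)) r :=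
    (Real.hasDerivAt_sinh _).comp r h1
  refine (h2.pow 2).congr_deriv ?_
  have := Real.sinh_two_mul (r / 2)
  rw [show 2 * (r / 2) = r by ring] at this
  rw [this]
  norm_num
  ring

/-- `d/dr (sinh r / 2) = cosh r / 2`. [folklore] -/
theorem hasDerivAt_sinh_half (r : ℝ) : HasDerivAt (fun r : ℝ => Real.sinh r / 2) (Real.cosh r / 2) r :=
  (Real.hasDerivAt_sinh r).div_const 2

/-- The point-pair invariant `u(·, w)` extended to `ℂ` agrees near points of `ℍ` with a rational
function. [folklore] -/
theorem pointPairInv_ofComplex_eventuallyEq (w : ℍ) (p₀ : ℍ) :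
    (fun p : ℂ => pointPairInv (ofComplex p) w) =ᶠ[𝓝 (p₀ : ℂ)]
      fun p : ℂ => ((p.re - w.re) ^ 2 + (p.im - w.im) ^ 2) / (4 * w.im * p.im) := by
  filter_upwards [isOpen_upperHalfPlaneSet.mem_nhds p₀.im_pos] with p hp
  rw [pointPairInv_comm, pointPairInv_ofComplex w hp]

/-- The coordinate formula of `u(·, w)` is smooth on the upper half-plane. [folklore] -/
theorem contDiffOn_uc (w : ℍ) :
    ContDiffOn ℝ 2 (fun p : ℂ => ((p.re - w.re) ^ 2 + (p.im - w.im) ^ 2) / (4 * w.im * p.im)) {p : ℂ | 0 < p.im} := by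
  have hre : ContDiff ℝ 2 fun p : ℂ => p.re := Complex.reCLM.contDiff
  have him : ContDiff ℝ 2 fun p : ℂ => p.im := Complex.imCLM.contDiff
  have h1 : ContDiff ℝ 2 fun p : ℂ => (p.re - w.re) ^ 2 + (p.im - w.im) ^ 2 :=
    ((hre.sub contDiff_const).pow 2).add ((him.sub contDiff_const).pow 2)
  have h2 : ContDiff ℝ 2 fun p : ℂ => 4 * w.im * p.im := contDiff_const.mul him
  refine h1.contDiffOn.div h2.contDiffOn fun p hp => ?_
  have : (0 : ℝ) < p.im := hp
  have := w.im_pos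
  positivity

/-- `Δ` of a `C²` function on `ℍ` is continuous. [folklore] -/
theorem continuous_hypLaplacian {F : ℍ → ℂ} (hF : IsC2 F) : Continuous (hypLaplacian F) := by
  unfold hypLaplacian
  have hU : IsOpen {p : ℂ | 0 < p.im} := isOpen_upperHalfPlaneSet
  have h1 : ContDiffOn ℝ 1 (fderiv ℝ (F ∘ ofComplex)) {p : ℂ | 0 < p.im} := hF.fderiv_of_isOpen hU (by norm_num)
  have h2 : ContinuousOn (fderiv ℝ (fderiv ℝ (F ∘ ofComplex))) {p : ℂ | 0 < p.im} :=
    h1.continuousOn_fderiv_of_isOpen hU le_rfl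
  have h3 : ContinuousOn (fun p => Δ (F ∘ ofComplex : ℂ → ℂ) p) {p : ℂ | 0 < p.im} := by
    have e : (fun p => Δ (F ∘ ofComplex : ℂ → ℂ) p) = fun p =>
        fderiv ℝ (fderiv ℝ (F ∘ ofComplex)) p 1 1 + fderiv ℝ (fderiv ℝ (F ∘ ofComplex)) p Complex.I Complex.I :=
      funext fun p => laplacian_eq_fderiv_fderiv _ p
    rw [e]
    refine ContinuousOn.add ?_ ?_
    · exact ((ContinuousLinearMap.apply ℝ ℂ (1 : ℂ)).continuous.comp_continuousOn
        ((ContinuousLinearMap.apply ℝ (ℂ →L[ℝ] ℂ) (1 : ℂ)).continuous.comp_continuousOn h2))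
    · exact ((ContinuousLinearMap.apply ℝ ℂ Complex.I).continuous.comp_continuousOn
        ((ContinuousLinearMap.apply ℝ (ℂ →L[ℝ] ℂ) Complex.I).continuous.comp_continuousOn h2))
  have h4 : Continuous fun z : ℍ => Δ (F ∘ ofComplex : ℂ → ℂ) (z : ℂ) :=
    h3.comp_continuous UpperHalfPlane.continuous_coe fun z => z.im_pos
  exact ((Complex.continuous_ofReal.comp UpperHalfPlane.continuous_im).pow 2).mul h4

/-- `k''` is continuous for `k ∈ C²` with `k'`, `k''` its first two derivatives. [folklore] -/
theorem continuous_k'' (hk : ∀ u, HasDerivAt k (k' u) u) (hk' : ∀ u, HasDerivAt k' (k'' u) u)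
    (hkc : ContDiff ℝ 2 k) : Continuous k'' := by
  have e1 : deriv k = k' := funext fun u => (hk u).deriv
  have e2 : deriv k' = k'' := funext fun u => (hk' u).deriv
  have h := (contDiff_succ_iff_deriv.mp (show ContDiff ℝ (1 + 1) k from hkc)).2.2
  rw [e1] at h
  have := h.continuous_deriv le_rfl
  rwa [e2] at this

/-- `k'` is continuous. [folklore] -/
theorem continuous_k' (hk' : ∀ u, HasDerivAt k' (k'' u) u) : Continuous k' := by
  have e2 : ∀ u, HasDerivAt k' (k'' u) u := hk'
  exact continuous_iff_continuousAt.mpr fun u => (e2 u).continuousAt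

variable (hk : ∀ u, HasDerivAt k (k' u) u) (hk' : ∀ u, HasDerivAt k' (k'' u) u) (hkc : ContDiff ℝ 2 k)
include hkc

/-- For `k ∈ C²(ℝ)` the kernel `z ↦ k(u(z, w))` is `C²` on `ℍ`. [folklore] -/
theorem isC2_radial_kernel (w : ℍ) : IsC2 (fun z : ℍ => (k (pointPairInv z w) : ℂ)) := by
  intro p hp
  have hp' : 0 < p.im := hp
  have e : ((fun z : ℍ => (k (pointPairInv z w) : ℂ)) ∘ ofComplex : ℂ → ℂ) =ᶠ[𝓝 p]
      fun p : ℂ => (k (((p.re - w.re) ^ 2 + (p.im - w.im) ^ 2) / (4 * w.im * p.im)) : ℂ) := by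
    filter_upwards [pointPairInv_ofComplex_eventuallyEq w ⟨p, hp'⟩] with q hq
    simp only [Function.comp_apply, hq]
  have h : ContDiffAt ℝ 2 (fun p : ℂ => (k (((p.re - w.re) ^ 2 + (p.im - w.im) ^ 2) / (4 * w.im * p.im)) : ℂ)) p := by
    have h1 := (contDiffOn_uc w).contDiffAt (isOpen_upperHalfPlaneSet.mem_nhds hp')
    exact (Complex.ofRealCLM.contDiff.comp hkc).contDiffAt.comp p h1
  exact (h.congr_of_eventuallyEq e).contDiffWithinAt

/-- The polar profile is constant in `φ`: `∂_φ g = 0`. [folklore] -/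
theorem dsnd_polarFn_radial (q : ℝ × ℝ) :
    dsnd (polarFn (fun z : ℍ => (k (pointPairInv z UpperHalfPlane.I) : ℂ))) q = 0 := by
  set F : ℍ → ℂ := fun z => (k (pointPairInv z UpperHalfPlane.I) : ℂ)
  have hF : IsC2 F := isC2_radial_kernel hkc UpperHalfPlane.I
  have hd : Differentiable ℝ (polarFn F) := (contDiff_polarFn hF).differentiable (by norm_num)
  have h1 : HasDerivAt (fun φ => polarFn F (q.1, φ)) (dsnd (polarFn F) q) q.2 := hasDerivAt_slice_snd (hd _)
  have e : (fun φ => polarFn F (q.1, φ)) = fun _ => ((k (Real.sinh (q.1 / 2) ^ 2) : ℝ) : ℂ) :=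
    funext fun φ => polarFn_radial_kernel k (q.1, φ)
  rw [e] at h1
  exact h1.unique (hasDerivAt_const _ _)

/-- `∂_φ² g = 0` for the radial kernel. [folklore] -/
theorem dsnd_dsnd_polarFn_radial (q : ℝ × ℝ) :
    dsnd (dsnd (polarFn (fun z : ℍ => (k (pointPairInv z UpperHalfPlane.I) : ℂ)))) q = 0 := by
  have e : dsnd (polarFn (fun z : ℍ => (k (pointPairInv z UpperHalfPlane.I) : ℂ))) = fun _ => 0 :=
    funext fun q => dsnd_polarFn_radial hkc q
  rw [e]
  simp [dsnd]

include hk hk'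

omit hk' in
/-- First `r`-derivative of the polar profile. [folklore] -/
theorem dfst_polarFn_radial (r φ : ℝ) :
    dfst (polarFn (fun z : ℍ => (k (pointPairInv z UpperHalfPlane.I) : ℂ))) (r, φ) =
      ((k' (Real.sinh (r / 2) ^ 2) * (Real.sinh r / 2) : ℝ) : ℂ) := by
  set F : ℍ → ℂ := fun z => (k (pointPairInv z UpperHalfPlane.I) : ℂ)
  have hF : IsC2 F := isC2_radial_kernel hkc UpperHalfPlane.I
  have hd : Differentiable ℝ (polarFn F) := (contDiff_polarFn hF).differentiable (by norm_num)
  have h1 : HasDerivAt (fun r => polarFn F (r, φ)) (dfst (polarFn F) (r, φ)) r :=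
    hasDerivAt_slice_fst (q := (r, φ)) (hd _)
  have h2 : HasDerivAt (fun r => polarFn F (r, φ)) (((k' (Real.sinh (r / 2) ^ 2) * (Real.sinh r / 2) : ℝ) : ℂ)) r := by
    have e : (fun r => polarFn F (r, φ)) = fun r => ((k (Real.sinh (r / 2) ^ 2) : ℝ) : ℂ) :=
      funext fun r => polarFn_radial_kernel k (r, φ)
    rw [e]
    have hA : HasDerivAt (fun r => k (Real.sinh (r / 2) ^ 2)) (k' (Real.sinh (r / 2) ^ 2) * (Real.sinh r / 2)) r := by
      have := (hk _).comp r (hasDerivAt_sinh_sq_half r)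
      simpa [Function.comp_def] using this
    exact hA.ofReal_comp
  exact h1.unique h2

/-- Second `r`-derivative of the polar profile. [folklore] -/
theorem dfst_dfst_polarFn_radial (r φ : ℝ) :
    dfst (dfst (polarFn (fun z : ℍ => (k (pointPairInv z UpperHalfPlane.I) : ℂ)))) (r, φ) =
      ((k'' (Real.sinh (r / 2) ^ 2) * (Real.sinh r / 2) ^ 2 + k' (Real.sinh (r / 2) ^ 2) * (Real.cosh r / 2) : ℝ) : ℂ) := by
  set F : ℍ → ℂ := fun z => (k (pointPairInv z UpperHalfPlane.I) : ℂ)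
  have hF : IsC2 F := isC2_radial_kernel hkc UpperHalfPlane.I
  have hd1 : Differentiable ℝ (dfst (polarFn F)) := (contDiff_dfst (n := 1) (contDiff_polarFn hF)).differentiable (by norm_num)
  have h1 : HasDerivAt (fun r => dfst (polarFn F) (r, φ)) (dfst (dfst (polarFn F)) (r, φ)) r :=
    hasDerivAt_slice_fst (q := (r, φ)) (hd1 _)
  have e : (fun r => dfst (polarFn F) (r, φ)) = fun r => ((k' (Real.sinh (r / 2) ^ 2) * (Real.sinh r / 2) : ℝ) : ℂ) :=
    funext fun r => dfst_polarFn_radial hk hkc r φ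
  rw [e] at h1
  have h2 : HasDerivAt (fun r => ((k' (Real.sinh (r / 2) ^ 2) * (Real.sinh r / 2) : ℝ) : ℂ))
      ((k'' (Real.sinh (r / 2) ^ 2) * (Real.sinh r / 2) ^ 2 + k' (Real.sinh (r / 2) ^ 2) * (Real.cosh r / 2) : ℝ) : ℂ) r := by
    have hA : HasDerivAt (fun r => k' (Real.sinh (r / 2) ^ 2)) (k'' (Real.sinh (r / 2) ^ 2) * (Real.sinh r / 2)) r := by
      have := (hk' _).comp r (hasDerivAt_sinh_sq_half r)
      simpa [Function.comp_def] using this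
    have h3 : HasDerivAt (fun r => k' (Real.sinh (r / 2) ^ 2) * (Real.sinh r / 2))
        (k'' (Real.sinh (r / 2) ^ 2) * (Real.sinh r / 2) * (Real.sinh r / 2) +
          k' (Real.sinh (r / 2) ^ 2) * (Real.cosh r / 2)) r := hA.mul (hasDerivAt_sinh_half r)
    refine h3.ofReal_comp.congr_deriv ?_
    push_cast; ring
  exact h1.unique h2

/-- Lemma 1.8 about `i`, off the centre: for `z = k(φ)(i e^r)`, `r ≠ 0`,
`Δ_z k(u(z, i)) = u(u+1) k''(u) + (2u+1) k'(u)`, `u = u(z, i) = sinh²(r/2)`.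
[cite: Iwaniec2002, Lemma 1.8 & (1.20)–(1.21), PDF pp. 16, 21] -/
theorem hypLaplacian_radial_kernel_I_of_ne {r : ℝ} (hr : r ≠ 0) (φ : ℝ) :
    hypLaplacian (fun z : ℍ => (k (pointPairInv z UpperHalfPlane.I) : ℂ)) (rot φ • axisPt r) =
      (kernelLaplacian k' k'' (Real.sinh (r / 2) ^ 2) : ℂ) := by
  have hF : IsC2 (fun z : ℍ => (k (pointPairInv z UpperHalfPlane.I) : ℂ)) := isC2_radial_kernel hkc UpperHalfPlane.I
  have h := polarLaplacian_identity hF hr φ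
  rw [dfst_polarFn_radial hk hkc, dfst_dfst_polarFn_radial hk hk' hkc, dsnd_dsnd_polarFn_radial hkc] at h
  have hs : Real.sinh r ≠ 0 := Real.sinh_ne_zero.mpr hr
  have hsC : (Real.sinh r : ℂ) ≠ 0 := by exact_mod_cast hs
  simp only [mul_zero, add_zero] at h
  have key : hypLaplacian (fun z : ℍ => (k (pointPairInv z UpperHalfPlane.I) : ℂ)) (rot φ • axisPt r) =
      ((Real.cosh r * (k' (Real.sinh (r / 2) ^ 2) * (Real.sinh r / 2)) +
        Real.sinh r * (k'' (Real.sinh (r / 2) ^ 2) * (Real.sinh r / 2) ^ 2 + k' (Real.sinh (r / 2) ^ 2) * (Real.cosh r / 2)) : ℝ) : ℂ) /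
        (Real.sinh r : ℂ) := by
    rw [eq_div_iff hsC]
    push_cast at h ⊢
    linear_combination -h
  rw [key, kernelLaplacian]
  -- the hyperbolic identities: sinh r = 2 sinh(r/2)cosh(r/2), cosh r = 1 + 2u, cosh²(r/2) = 1 + u, u = sinh²(r/2)
  set u : ℝ := Real.sinh (r / 2) ^ 2 with hu
  set S : ℝ := Real.sinh r with hSdef
  set C : ℝ := Real.cosh r with hCdef
  set sh : ℝ := Real.sinh (r / 2) with hsh
  set ch : ℝ := Real.cosh (r / 2) with hch
  have h1 : S = 2 * sh * ch := by
    rw [hSdef, hsh, hch, ← Real.sinh_two_mul]; ring_nf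
  have h2 : C = 1 + 2 * u := by
    have := Real.cosh_two_mul (r / 2)
    rw [show 2 * (r / 2) = r by ring] at this
    rw [hCdef, this, hu, Real.cosh_sq']; ring
  have h3 : ch ^ 2 = 1 + u := by rw [hch, hu, Real.cosh_sq']
  have h4 : u = sh ^ 2 := by rw [hu, hsh]
  have key2 := alg18 (k' u : ℂ) (k'' u : ℂ) S C u sh ch (by exact_mod_cast h1) (by exact_mod_cast h2)
    (by exact_mod_cast h3) (by exact_mod_cast h4)
  rw [div_eq_iff hsC]
  push_cast
  linear_combination -key2


/-- **Lemma 1.8 about `i`**: `Δ_z k(u(z, i)) = u(u+1) k''(u) + (2u+1) k'(u)` at every `z`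
(off `i` by polar coordinates, at `i` by continuity). [cite: Iwaniec2002, Lemma 1.8 & (1.21), PDF pp. 16, 21] -/
theorem hypLaplacian_radial_kernel_I (z : ℍ) :
    hypLaplacian (fun z : ℍ => (k (pointPairInv z UpperHalfPlane.I) : ℂ)) z =
      (kernelLaplacian k' k'' (pointPairInv z UpperHalfPlane.I) : ℂ) := by
  set F : ℍ → ℂ := fun z => (k (pointPairInv z UpperHalfPlane.I) : ℂ) with hFdef
  have hF : IsC2 F := isC2_radial_kernel hkc UpperHalfPlane.I
  -- both sides are continuous in z
  have hL : Continuous (hypLaplacian F) := continuous_hypLaplacian hF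
  have hR : Continuous fun z : ℍ => (kernelLaplacian k' k'' (pointPairInv z UpperHalfPlane.I) : ℂ) := by
    refine Complex.continuous_ofReal.comp ?_
    unfold kernelLaplacian
    have hu : Continuous fun z : ℍ => pointPairInv z UpperHalfPlane.I := by
      have h := continuous_pointPairInv UpperHalfPlane.I
      have e : (fun z : ℍ => pointPairInv UpperHalfPlane.I z) = fun z => pointPairInv z UpperHalfPlane.I :=
        funext fun z => pointPairInv_comm _ _
      rwa [e] at h
    have hk'c := continuous_k' hk'
    have hk''c := continuous_k'' hk hk' hkc
    fun_prop
  -- they agree off `i`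
  have heq : EqOn (hypLaplacian F) (fun z : ℍ => (kernelLaplacian k' k'' (pointPairInv z UpperHalfPlane.I) : ℂ))
      {z : ℍ | z ≠ UpperHalfPlane.I} := by
    intro z hz
    obtain ⟨θ, r, rfl⟩ := exists_eq_rot_smul_axisPt z
    have hr : r ≠ 0 := by
      rintro rfl
      exact hz (by rw [axisPt_zero, rot_smul_I])
    show hypLaplacian F (rot θ • axisPt r) = (kernelLaplacian k' k'' (pointPairInv (rot θ • axisPt r) UpperHalfPlane.I) : ℂ)
    rw [hFdef, hypLaplacian_radial_kernel_I_of_ne hk hk' hkc hr θ, radial_kernel_rot (fun u => u) θ, pointPairInv_axisPt_I]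
  have hdense : Dense {z : ℍ | z ≠ UpperHalfPlane.I} := dense_compl_singleton UpperHalfPlane.I
  exact congrFun (hL.ext_on hdense hR heq) z

/-- **Iwaniec, Lemma 1.8** (via (1.21)): for `k ∈ C²(ℝ)` with derivatives `k'`, `k''` and every
`z, w ∈ ℍ`, `Δ_z k(u(z, w)) = u(u + 1) k''(u) + (2u + 1) k'(u)` with `u = u(z, w)` — the Laplacian
of a point-pair invariant kernel is again a point-pair invariant kernel. (About `i` by geodesic polar
coordinates, (1.20), and in general by transitivity of `SL₂(ℝ)` and the invariance of `Δ`.)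
[cite: Iwaniec2002, Lemma 1.8 & (1.20)–(1.21), PDF pp. 16, 21] -/
theorem hypLaplacian_radial_kernel (z w : ℍ) :
    hypLaplacian (fun z : ℍ => (k (pointPairInv z w) : ℂ)) z = (kernelLaplacian k' k'' (pointPairInv z w) : ℂ) := by
  obtain ⟨σ, hσ⟩ := MulAction.exists_smul_eq SL(2, ℝ) UpperHalfPlane.I w
  set FI : ℍ → ℂ := fun z => (k (pointPairInv z UpperHalfPlane.I) : ℂ) with hFI
  have hFI : IsC2 FI := isC2_radial_kernel hkc UpperHalfPlane.I
  -- k(u(z, w)) = FI (σ⁻¹ z)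
  have e : (fun z : ℍ => (k (pointPairInv z w) : ℂ)) = fun z => FI (σ⁻¹ • z) := by
    funext z
    show (k (pointPairInv z w) : ℂ) = (k (pointPairInv (σ⁻¹ • z) UpperHalfPlane.I) : ℂ)
    rw [← hσ, ← pointPairInv_smul σ⁻¹ z (σ • UpperHalfPlane.I), inv_smul_smul]
  rw [e]
  have hdet : 0 < ((Matrix.SpecialLinearGroup.toGL σ⁻¹ : GL (Fin 2) ℝ)).det.val := by simp
  have hcd : ContDiffAt ℝ 2 (FI ∘ ofComplex)
      ((((Matrix.SpecialLinearGroup.toGL σ⁻¹ : GL (Fin 2) ℝ)) • z : ℍ) : ℂ) :=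
    hFI.contDiffAt (isOpen_upperHalfPlaneSet.mem_nhds (((Matrix.SpecialLinearGroup.toGL σ⁻¹ : GL (Fin 2) ℝ)) • z).im_pos)
  have h := hypLaplacian_comp_smul hdet FI z hcd
  have e1 : (fun w' : ℍ => FI (((Matrix.SpecialLinearGroup.toGL σ⁻¹ : GL (Fin 2) ℝ)) • w')) = fun w' => FI (σ⁻¹ • w') := rfl
  rw [show ((Matrix.SpecialLinearGroup.toGL σ⁻¹ : GL (Fin 2) ℝ)) • z = σ⁻¹ • z from rfl, e1] at h
  rw [h, hypLaplacian_radial_kernel_I hk hk' hkc (σ⁻¹ • z)]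
  congr 2
  rw [← hσ, ← pointPairInv_smul σ⁻¹ z (σ • UpperHalfPlane.I), inv_smul_smul]

end Lemma18

/-! ## Theorem 1.9 (kernel form): `L_k f ∈ C²` and `Δ L_k f = L_{Δk} f` for `k ∈ C²_c`, `f ∈ L¹_loc` -/

section Theorem19

variable {k k' k'' : ℝ → ℝ}

/-- The kernel `k(u(p, q))` as a function of `(p, q) ∈ ℂ × ℂ` through the coordinate formula (1.4). [cite: Iwaniec2002, (1.4), PDF p. 9] -/
def kJoint (k : ℝ → ℝ) (q : ℂ × ℂ) : ℂ :=
  (k (((q.1.re - q.2.re) ^ 2 + (q.1.im - q.2.im) ^ 2) / (4 * q.2.im * q.1.im)) : ℂ)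

/-- The coordinate formula of `u` on `ℂ × ℂ`. [cite: Iwaniec2002, (1.4), PDF p. 9] -/
def uJoint (q : ℂ × ℂ) : ℝ := ((q.1.re - q.2.re) ^ 2 + (q.1.im - q.2.im) ^ 2) / (4 * q.2.im * q.1.im)

/-- `kJoint k = k ∘ uJoint` (cast to `ℂ`). [folklore] -/
theorem kJoint_eq (k : ℝ → ℝ) (q : ℂ × ℂ) : kJoint k q = (k (uJoint q) : ℂ) := rfl

/-- On `ℍ × ℍ` the coordinate formula is the point-pair invariant. [folklore] -/
theorem uJoint_coe (p : ℂ) (hp : 0 < p.im) (w : ℍ) : uJoint (p, (w : ℂ)) = pointPairInv (ofComplex p) w := by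
  rw [pointPairInv_comm, pointPairInv_ofComplex w hp]
  simp [uJoint]

/-- The open set `ℍ × ℍ ⊂ ℂ × ℂ`. [folklore] -/
theorem isOpen_UU : IsOpen ({p : ℂ | 0 < p.im} ×ˢ {p : ℂ | 0 < p.im}) :=
  isOpen_upperHalfPlaneSet.prod isOpen_upperHalfPlaneSet

/-- `uJoint` is smooth on `ℍ × ℍ`. [folklore] -/
theorem contDiffOn_uJoint : ContDiffOn ℝ 2 uJoint ({p : ℂ | 0 < p.im} ×ˢ {p : ℂ | 0 < p.im}) := by
  have hre1 : ContDiff ℝ 2 fun q : ℂ × ℂ => q.1.re := Complex.reCLM.contDiff.comp contDiff_fst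
  have him1 : ContDiff ℝ 2 fun q : ℂ × ℂ => q.1.im := Complex.imCLM.contDiff.comp contDiff_fst
  have hre2 : ContDiff ℝ 2 fun q : ℂ × ℂ => q.2.re := Complex.reCLM.contDiff.comp contDiff_snd
  have him2 : ContDiff ℝ 2 fun q : ℂ × ℂ => q.2.im := Complex.imCLM.contDiff.comp contDiff_snd
  have h1 : ContDiff ℝ 2 fun q : ℂ × ℂ => (q.1.re - q.2.re) ^ 2 + (q.1.im - q.2.im) ^ 2 :=
    ((hre1.sub hre2).pow 2).add ((him1.sub him2).pow 2)
  have h2 : ContDiff ℝ 2 fun q : ℂ × ℂ => 4 * q.2.im * q.1.im := (contDiff_const.mul him2).mul him1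
  refine h1.contDiffOn.div h2.contDiffOn fun q hq => ?_
  have h3 : (0 : ℝ) < q.1.im := hq.1
  have h4 : (0 : ℝ) < q.2.im := hq.2
  positivity

/-- `uJoint` is continuous on `ℍ × ℍ`. [folklore] -/
theorem continuousOn_uJoint : ContinuousOn uJoint ({p : ℂ | 0 < p.im} ×ˢ {p : ℂ | 0 < p.im}) :=
  contDiffOn_uJoint.continuousOn

/-- The `ofComplex`-extension of `L_k f` near a point of `ℍ` is the joint-kernel integral. [folklore] -/
theorem invariantOperator_ofComplex_eq (k : ℝ → ℝ) {f : ℍ → ℂ} {p : ℂ} (hp : 0 < p.im) :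
    invariantOperator k f (ofComplex p) = ∫ w : ℍ, kJoint k (p, (w : ℂ)) * f w := by
  unfold invariantOperator
  congr 1 with w
  rw [kJoint_eq, uJoint_coe p hp w]

variable (hkc : ContDiff ℝ 2 k)
include hkc

/-- `kJoint k` is `C²` on `ℍ × ℍ` for `k ∈ C²`. [folklore] -/
theorem contDiffOn_kJoint : ContDiffOn ℝ 2 (kJoint k) ({p : ℂ | 0 < p.im} ×ˢ {p : ℂ | 0 < p.im}) :=
  (Complex.ofRealCLM.contDiff.comp hkc).comp_contDiffOn contDiffOn_uJoint


/-! ### Generic level: a `C¹` function `G` on `ℍ × ℍ ⊂ ℂ × ℂ`, its partial derivative in the first variable -/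

/-- The partial derivative in the first variable: `D₁G(q) = DG(q) ∘ inl`. [folklore] -/
def pD1 (G : ℂ × ℂ → ℂ) (q : ℂ × ℂ) : ℂ →L[ℝ] ℂ := (fderiv ℝ G q).comp (ContinuousLinearMap.inl ℝ ℂ ℂ)

omit hkc in
/-- `D₁G(q)[v] = DG(q)[(v, 0)]`. [folklore] -/
theorem pD1_apply (G : ℂ × ℂ → ℂ) (q : ℂ × ℂ) (v : ℂ) : pD1 G q v = fderiv ℝ G q (v, 0) := by
  simp [pD1]

omit hkc in
/-- `p ↦ G(p, c)` has derivative `D₁G(p, c)` for `G ∈ C¹(ℍ × ℍ)`. [folklore] -/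
theorem hasFDerivAt_left {G : ℂ × ℂ → ℂ} (hG : ContDiffOn ℝ 1 G ({p : ℂ | 0 < p.im} ×ˢ {p : ℂ | 0 < p.im}))
    {p c : ℂ} (hp : 0 < p.im) (hc : 0 < c.im) : HasFDerivAt (fun p => G (p, c)) (pD1 G (p, c)) p := by
  have hq : (p, c) ∈ {p : ℂ | 0 < p.im} ×ˢ {p : ℂ | 0 < p.im} := ⟨hp, hc⟩
  have hJ : HasFDerivAt G (fderiv ℝ G (p, c)) (p, c) :=
    ((hG.differentiableOn one_ne_zero).differentiableAt (isOpen_UU.mem_nhds hq)).hasFDerivAt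
  exact hJ.comp p (hasFDerivAt_prodMk_left p c)

omit hkc in
/-- Continuity of `D₁G` on `ℍ × ℍ`. [folklore] -/
theorem continuousOn_pD1 {G : ℂ × ℂ → ℂ} (hG : ContDiffOn ℝ 1 G ({p : ℂ | 0 < p.im} ×ˢ {p : ℂ | 0 < p.im})) :
    ContinuousOn (pD1 G) ({p : ℂ | 0 < p.im} ×ˢ {p : ℂ | 0 < p.im}) := by
  have h := hG.continuousOn_fderiv_of_isOpen isOpen_UU le_rfl
  unfold pD1
  exact h.clm_comp continuousOn_const

omit hkc in
/-- `D₁G = 0` where `G` vanishes identically near the point. [folklore] -/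
theorem pD1_eq_zero_of_eventuallyEq {G : ℂ × ℂ → ℂ} {q : ℂ × ℂ} (h : G =ᶠ[𝓝 q] fun _ => 0) : pD1 G q = 0 := by
  unfold pD1
  rw [h.fderiv_eq]
  simp

/-! ### Vanishing beyond the support -/

variable {M : ℝ} (hM : ∀ u, M ≤ u → k u = 0)
include hM

omit hkc hM in
/-- The open region of `ℍ × ℍ` where `u > M`. [folklore] -/
theorem isOpen_farSet : IsOpen {q : ℂ × ℂ | q ∈ {p : ℂ | 0 < p.im} ×ˢ {p : ℂ | 0 < p.im} ∧ M < uJoint q} := by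
  have h := continuousOn_uJoint.isOpen_inter_preimage isOpen_UU (isOpen_Ioi (a := M))
  convert h using 1
  exact Set.ext fun q => Iff.rfl

omit hkc in
/-- Beyond the support the joint kernel vanishes identically near the point. [folklore] -/
theorem kJoint_eventuallyEq_zero {q : ℂ × ℂ} (hq : q ∈ {p : ℂ | 0 < p.im} ×ˢ {p : ℂ | 0 < p.im}) (hu : M < uJoint q) :
    kJoint k =ᶠ[𝓝 q] fun _ => 0 := by
  have hmem : q ∈ {q : ℂ × ℂ | q ∈ {p : ℂ | 0 < p.im} ×ˢ {p : ℂ | 0 < p.im} ∧ M < uJoint q} := ⟨hq, hu⟩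
  filter_upwards [(isOpen_farSet (M := M)).mem_nhds hmem] with q' hq'
  rw [kJoint_eq, hM _ hq'.2.le]
  simp

omit hkc in
/-- Hence every `q ↦ D(kJoint k)(q)[V]` vanishes identically near such points. [folklore] -/
theorem fderiv_kJoint_apply_eventuallyEq_zero {q : ℂ × ℂ} (hq : q ∈ {p : ℂ | 0 < p.im} ×ˢ {p : ℂ | 0 < p.im})
    (hu : M < uJoint q) (V : ℂ × ℂ) : (fun q => fderiv ℝ (kJoint k) q V) =ᶠ[𝓝 q] fun _ => 0 := by
  have hmem : q ∈ {q : ℂ × ℂ | q ∈ {p : ℂ | 0 < p.im} ×ˢ {p : ℂ | 0 < p.im} ∧ M < uJoint q} := ⟨hq, hu⟩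
  filter_upwards [(isOpen_farSet (M := M)).mem_nhds hmem] with q' hq'
  rw [(kJoint_eventuallyEq_zero hM hq'.1 hq'.2).fderiv_eq]
  simp

/-! ### The geometry of the support -/

omit hkc hM in
/-- For `p` in the closed Euclidean disc of radius `Im p₀/2` about `p₀`: `Im p > 0` and `u(p, p₀) ≤ 1/8`. [folklore] -/
theorem pointPairInv_le_of_mem_closedBall {p₀ : ℂ} (hp₀ : 0 < p₀.im) {p : ℂ} (hp : p ∈ Metric.closedBall p₀ (p₀.im / 2)) :
    0 < p.im ∧ pointPairInv (ofComplex p) ⟨p₀, hp₀⟩ ≤ 1 / 8 := by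
  rw [Metric.mem_closedBall, Complex.dist_eq] at hp
  have him : |p.im - p₀.im| ≤ p₀.im / 2 := by
    have := Complex.abs_im_le_norm (p - p₀)
    simp only [Complex.sub_im] at this
    exact this.trans hp
  have hpim : p₀.im / 2 ≤ p.im := by linarith [abs_le.mp him |>.1]
  have hppos : 0 < p.im := by linarith
  refine ⟨hppos, ?_⟩
  rw [pointPairInv_comm, pointPairInv_ofComplex _ hppos]
  change ((p.re - p₀.re) ^ 2 + (p.im - p₀.im) ^ 2) / (4 * p₀.im * p.im) ≤ 1 / 8
  have hsq : (p.re - p₀.re) ^ 2 + (p.im - p₀.im) ^ 2 ≤ (p₀.im / 2) ^ 2 := by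
    have e : ‖p - p₀‖ ^ 2 = (p.re - p₀.re) ^ 2 + (p.im - p₀.im) ^ 2 := by
      rw [Complex.sq_norm, Complex.normSq_apply]; simp; ring
    rw [← e]
    exact pow_le_pow_left₀ (norm_nonneg _) hp 2
  rw [div_le_iff₀ (by positivity)]
  nlinarith

omit hkc hM in
/-- **Uniform compact support**: for `p` in the closed disc of radius `Im p₀/2` about `p₀` and `w`
outside the hyperbolic ball of radius `2 arsinh √M + 2 arsinh √(1/8)` about `p₀`: `u(p, w) > M`. [folklore] -/
theorem far_of_not_mem_ball {p₀ : ℂ} (hp₀ : 0 < p₀.im) {p : ℂ} (hp : p ∈ Metric.closedBall p₀ (p₀.im / 2))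
    {w : ℍ} (hw : w ∉ Metric.closedBall (⟨p₀, hp₀⟩ : ℍ) (2 * Real.arsinh (Real.sqrt M) + 2 * Real.arsinh (Real.sqrt (1 / 8)))) :
    (p, (w : ℂ)) ∈ {p : ℂ | 0 < p.im} ×ˢ {p : ℂ | 0 < p.im} ∧ M < uJoint (p, (w : ℂ)) := by
  obtain ⟨hppos, hu0⟩ := pointPairInv_le_of_mem_closedBall hp₀ hp
  refine ⟨⟨hppos, w.im_pos⟩, ?_⟩
  rw [uJoint_coe p hppos w]
  by_contra hle
  rw [not_lt] at hle
  apply hw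
  rw [Metric.mem_closedBall]
  have h1 : dist (ofComplex p) w ≤ 2 * Real.arsinh (Real.sqrt M) := dist_le_of_pointPairInv_le hle
  have h2 : dist (ofComplex p) ⟨p₀, hp₀⟩ ≤ 2 * Real.arsinh (Real.sqrt (1 / 8)) := dist_le_of_pointPairInv_le hu0
  calc dist w ⟨p₀, hp₀⟩ ≤ dist w (ofComplex p) + dist (ofComplex p) ⟨p₀, hp₀⟩ := dist_triangle _ _ _
    _ ≤ 2 * Real.arsinh (Real.sqrt M) + 2 * Real.arsinh (Real.sqrt (1 / 8)) := by rw [dist_comm]; linarith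

/-! ### One differentiation under the integral sign (generic level) -/

omit hkc hM in
/-- **Generic level.** Let `G ∈ C¹(ℍ × ℍ)` vanish, together with a neighbourhood, at every
`(p, w)` with `u(p, w) > M`, and let `f ∈ L¹_loc(ℍ)` with `w ↦ G(p₀, w) f(w)` integrable. Then
`p ↦ ∫ G(p, w) f(w) dμ(w)` has derivative `∫ f(w) D₁G(p₀, w) dμ(w)` at `p₀`, the latter integrand is
integrable, and `p ↦ ∫ f(w) D₁G(p, w) dμ(w)` is continuous at `p₀`. [folklore] -/
theorem hasFDerivAt_integral_level {G : ℂ × ℂ → ℂ}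
    (hG : ContDiffOn ℝ 1 G ({p : ℂ | 0 < p.im} ×ˢ {p : ℂ | 0 < p.im}))
    (hGz : ∀ q, q ∈ {p : ℂ | 0 < p.im} ×ˢ {p : ℂ | 0 < p.im} → M < uJoint q → G =ᶠ[𝓝 q] fun _ => 0)
    {f : ℍ → ℂ} (hf : LocallyIntegrable f) {p₀ : ℂ} (hp₀ : 0 < p₀.im)
    (hint : Integrable fun w : ℍ => G (p₀, (w : ℂ)) * f w) :
    HasFDerivAt (fun p => ∫ w : ℍ, G (p, (w : ℂ)) * f w) (∫ w : ℍ, (f w) • pD1 G (p₀, (w : ℂ))) p₀ ∧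
    Integrable (fun w : ℍ => (f w) • pD1 G (p₀, (w : ℂ))) ∧
    ContinuousAt (fun p => ∫ w : ℍ, (f w) • pD1 G (p, (w : ℂ))) p₀ := by
  -- the ball of parameters and the compact set of `w`
  set ε : ℝ := p₀.im / 2 with hε
  have hε0 : 0 < ε := by rw [hε]; linarith
  set z₀ : ℍ := ⟨p₀, hp₀⟩
  set R : ℝ := 2 * Real.arsinh (Real.sqrt M) + 2 * Real.arsinh (Real.sqrt (1 / 8)) with hR
  set S : Set ℍ := Metric.closedBall z₀ R with hS
  have hSc : IsCompact S := isCompact_closedBall z₀ R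
  set K : Set ℂ := Metric.closedBall p₀ ε with hK
  have hKc : IsCompact K := isCompact_closedBall p₀ ε
  set T : Set (ℂ × ℂ) := K ×ˢ ((fun w : ℍ => (w : ℂ)) '' S) with hT
  have hTc : IsCompact T := hKc.prod (hSc.image UpperHalfPlane.continuous_coe)
  have hKU : ∀ p ∈ K, 0 < p.im := fun p hp => (pointPairInv_le_of_mem_closedBall hp₀ hp).1
  have hTU : T ⊆ {p : ℂ | 0 < p.im} ×ˢ {p : ℂ | 0 < p.im} := by
    rintro ⟨p, c⟩ ⟨hp, ⟨w, hw, rfl⟩⟩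
    exact ⟨hKU p hp, w.im_pos⟩
  -- bound for D₁G on T
  obtain ⟨C₁, hC₁⟩ := hTc.exists_bound_of_continuousOn ((continuousOn_pD1 hG).mono hTU)
  -- vanishing off S for p ∈ K
  have hvan : ∀ p ∈ K, ∀ w : ℍ, w ∉ S → pD1 G (p, (w : ℂ)) = 0 := fun p hp w hw =>
    pD1_eq_zero_of_eventuallyEq (hGz _ (far_of_not_mem_ball hp₀ hp hw).1 (far_of_not_mem_ball hp₀ hp hw).2)
  -- the dominating function
  set bound : ℍ → ℝ := S.indicator fun w => C₁ * ‖f w‖ with hb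
  have hfS : IntegrableOn f S := hf.integrableOn_isCompact hSc
  have hbi : Integrable bound := by
    rw [hb]
    exact IntegrableOn.integrable_indicator (hfS.norm.const_mul C₁) Metric.isClosed_closedBall.measurableSet
  have hKball : Metric.ball p₀ ε ⊆ K := Metric.ball_subset_closedBall
  have hbound : ∀ w : ℍ, ∀ p ∈ Metric.ball p₀ ε, ‖(f w) • pD1 G (p, (w : ℂ))‖ ≤ bound w := by
    intro w p hp
    by_cases hw : w ∈ S
    · rw [hb, Set.indicator_of_mem hw, norm_smul, mul_comm]
      exact mul_le_mul_of_nonneg_right (hC₁ _ ⟨hKball hp, w, hw, rfl⟩) (norm_nonneg _)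
    · rw [hvan p (hKball hp) w hw, hb, Set.indicator_of_notMem hw]
      simp only [norm_le_zero_iff]
      exact smul_zero (A := ℂ →L[ℝ] ℂ) (f w)
  -- measurability (continuity in w for fixed p ∈ ℍ)
  have hcont0 : ∀ p : ℂ, 0 < p.im → Continuous fun w : ℍ => G (p, (w : ℂ)) := fun p hp =>
    hG.continuousOn.comp_continuous (continuous_const.prodMk UpperHalfPlane.continuous_coe) fun w => ⟨hp, w.im_pos⟩
  have hcont1 : ∀ p : ℂ, 0 < p.im → Continuous fun w : ℍ => pD1 G (p, (w : ℂ)) := fun p hp =>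
    (continuousOn_pD1 hG).comp_continuous (continuous_const.prodMk UpperHalfPlane.continuous_coe) fun w => ⟨hp, w.im_pos⟩
  have hball : Metric.ball p₀ ε ∈ 𝓝 p₀ := Metric.ball_mem_nhds p₀ hε0
  have hevU : ∀ᶠ p in 𝓝 p₀, 0 < p.im := isOpen_upperHalfPlaneSet.mem_nhds hp₀
  have hfm : AEStronglyMeasurable f volume := hf.aestronglyMeasurable
  have hL : HasFDerivAt (fun p => ∫ w : ℍ, G (p, (w : ℂ)) * f w) (∫ w : ℍ, (f w) • pD1 G (p₀, (w : ℂ))) p₀ := by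
    refine hasFDerivAt_integral_of_dominated_of_fderiv_le (𝕜 := ℝ) (μ := (volume : Measure ℍ))
      (F := fun (p : ℂ) (w : ℍ) => G (p, (w : ℂ)) * f w) (F' := fun (p : ℂ) (w : ℍ) => (f w) • pD1 G (p, (w : ℂ)))
      (x₀ := p₀) (s := Metric.ball p₀ ε) (bound := bound) hball ?_ hint ?_ ?_ hbi ?_
    · filter_upwards [hevU] with p hp
      exact (hcont0 p hp).aestronglyMeasurable.mul hfm
    · exact hfm.smul (hcont1 p₀ hp₀).aestronglyMeasurable
    · exact Eventually.of_forall fun w p hp => hbound w p hp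
    · refine Eventually.of_forall fun w p hp => ?_
      exact (hasFDerivAt_left hG (hKU p (hKball hp)) w.im_pos).mul_const (f w)
  have hint1 : Integrable fun w : ℍ => (f w) • pD1 G (p₀, (w : ℂ)) :=
    Integrable.mono' hbi (hfm.smul (hcont1 p₀ hp₀).aestronglyMeasurable)
      (Eventually.of_forall fun w => hbound w p₀ (Metric.mem_ball_self hε0))
  have hC : ContinuousAt (fun p => ∫ w : ℍ, (f w) • pD1 G (p, (w : ℂ))) p₀ := by
    refine continuousAt_of_dominated (μ := (volume : Measure ℍ))
      (F := fun (p : ℂ) (w : ℍ) => (f w) • pD1 G (p, (w : ℂ))) (x₀ := p₀) (bound := bound) ?_ ?_ hbi ?_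
    · filter_upwards [hevU] with p hp
      exact hfm.smul (hcont1 p hp).aestronglyMeasurable
    · filter_upwards [hball] with p hp
      exact Eventually.of_forall fun w => hbound w p hp
    · refine Eventually.of_forall fun w => ?_
      have hmem : (p₀, ((w : ℍ) : ℂ)) ∈ {p : ℂ | 0 < p.im} ×ˢ {p : ℂ | 0 < p.im} := ⟨hp₀, w.im_pos⟩
      have h2 : ContinuousAt (fun p : ℂ => (p, ((w : ℍ) : ℂ))) p₀ := continuousAt_id.prodMk continuousAt_const
      have h1 : ContinuousAt (pD1 G) (p₀, ((w : ℍ) : ℂ)) := (continuousOn_pD1 hG).continuousAt (isOpen_UU.mem_nhds hmem)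
      have h : ContinuousAt (fun p : ℂ => pD1 G (p, ((w : ℍ) : ℂ))) p₀ := ContinuousAt.comp (g := pD1 G) h1 h2
      exact h.const_smul (f w)
  exact ⟨hL, hint1, hC⟩


/-! ### Assembly: `L_k f` is `C²` and `Δ L_k f = L_{k_Δ} f` -/

variable (hk : IsTestKernel k)
include hk

omit hM in
/-- **Theorem 1.9, kernel form (regularity)**: for a test kernel `k ∈ C²(ℝ)` and `f ∈ L¹_loc(ℍ)` the
function `L_k f` is of class `C²` on `ℍ`, and (**Lemma 1.8 + differentiation under the integral**)
`Δ (L_k f)(z) = ∫_ℍ Δ_z k(u(z, w)) f(w) dμ(w) = (L_{k_Δ} f)(z)` with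
`k_Δ(u) = u(u+1)k''(u) + (2u+1)k'(u)` — "the invariant integral operators commute with the Laplace
operator", here in the form where `Δ` falls on the kernel, valid for every locally integrable `f`.
[cite: Iwaniec2002, Thm 1.9 & Lemma 1.8, PDF p. 21] -/
theorem isC2_invariantOperator_and_hypLaplacian (hk1 : ∀ u, HasDerivAt k (k' u) u) (hk2 : ∀ u, HasDerivAt k' (k'' u) u)
    {f : ℍ → ℂ} (hf : LocallyIntegrable f) :
    IsC2 (invariantOperator k f) ∧
      ∀ z : ℍ, hypLaplacian (invariantOperator k f) z = invariantOperator (kernelLaplacian k' k'') f z := by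
  obtain ⟨hkm, ⟨B, hB⟩, hez⟩ := id hk
  set M₀ : ℝ := Classical.choose hk.eventually_zero with hM₀
  have hM₀' : 0 ≤ M₀ ∧ ∀ u, M₀ ≤ u → k u = 0 := Classical.choose_spec hk.eventually_zero
  have hkM : ∀ u, M₀ ≤ u → k u = 0 := hM₀'.2
  set U : Set ℂ := {p : ℂ | 0 < p.im} with hUdef
  have hUo : IsOpen U := isOpen_upperHalfPlaneSet
  -- the two levels
  have hJ2 : ContDiffOn ℝ 2 (kJoint k) (U ×ˢ U) := contDiffOn_kJoint hkc
  have hJ1 : ContDiffOn ℝ 1 (kJoint k) (U ×ˢ U) := hJ2.of_le (by norm_num)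
  have hJz : ∀ q, q ∈ U ×ˢ U → M₀ < uJoint q → kJoint k =ᶠ[𝓝 q] fun _ => 0 := fun q hq hu =>
    kJoint_eventuallyEq_zero hkM hq hu
  set Gv : ℂ → ℂ × ℂ → ℂ := fun v q => fderiv ℝ (kJoint k) q (v, 0) with hGv
  have hGv1 : ∀ v, ContDiffOn ℝ 1 (Gv v) (U ×ˢ U) := fun v =>
    (hJ2.fderiv_of_isOpen isOpen_UU (by norm_num)).clm_apply contDiffOn_const
  have hGvz : ∀ v q, q ∈ U ×ˢ U → M₀ < uJoint q → Gv v =ᶠ[𝓝 q] fun _ => 0 := fun v q hq hu =>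
    fderiv_kJoint_apply_eventuallyEq_zero hkM hq hu (v, 0)
  set Φ : ℂ → ℂ := fun p => ∫ w : ℍ, kJoint k (p, (w : ℂ)) * f w with hΦ
  set Φ₁ : ℂ → (ℂ →L[ℝ] ℂ) := fun p => ∫ w : ℍ, (f w) • pD1 (kJoint k) (p, (w : ℂ)) with hΦ₁
  set Φ₂ : ℂ → ℂ → (ℂ →L[ℝ] ℂ) := fun v p => ∫ w : ℍ, (f w) • pD1 (Gv v) (p, (w : ℂ)) with hΦ₂
  have hint0 : ∀ p, 0 < p.im → Integrable fun w : ℍ => kJoint k (p, (w : ℂ)) * f w := by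
    intro p hp
    have h := integrable_kernel_mul hk hf (ofComplex p)
    refine h.congr (Eventually.of_forall fun w => ?_)
    simp only [kJoint_eq, uJoint_coe p hp w]
  -- level 1
  have hA : ∀ p, 0 < p.im → HasFDerivAt Φ (Φ₁ p) p ∧ Integrable (fun w : ℍ => (f w) • pD1 (kJoint k) (p, (w : ℂ))) ∧
      ContinuousAt Φ₁ p := fun p hp =>
    hasFDerivAt_integral_level hJ1 hJz hf hp (hint0 p hp)
  -- level 2 for each direction v
  have hintv : ∀ v p, 0 < p.im → Integrable fun w : ℍ => Gv v (p, (w : ℂ)) * f w := by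
    intro v p hp
    have h := (ContinuousLinearMap.apply ℝ ℂ v).integrable_comp (hA p hp).2.1
    refine h.congr (Eventually.of_forall fun w => ?_)
    simp [hGv, pD1_apply, mul_comm]
  have hBv : ∀ v p, 0 < p.im → HasFDerivAt (fun p => ∫ w : ℍ, Gv v (p, (w : ℂ)) * f w) (Φ₂ v p) p ∧
      Integrable (fun w : ℍ => (f w) • pD1 (Gv v) (p, (w : ℂ))) ∧ ContinuousAt (Φ₂ v) p := fun v p hp =>
    hasFDerivAt_integral_level (hGv1 v) (hGvz v) hf hp (hintv v p hp)
  -- Φ₁ p v = ∫ Gv v (p, w) f(w)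
  have hΦ₁v : ∀ v p, 0 < p.im → Φ₁ p v = ∫ w : ℍ, Gv v (p, (w : ℂ)) * f w := by
    intro v p hp
    simp only [hΦ₁]
    rw [ContinuousLinearMap.integral_apply (hA p hp).2.1 v]
    congr 1 with w
    simp [hGv, pD1_apply, mul_comm]
  have hCv : ∀ v p, 0 < p.im → HasFDerivAt (fun p => Φ₁ p v) (Φ₂ v p) p := by
    intro v p hp
    refine (hBv v p hp).1.congr_of_eventuallyEq ?_
    filter_upwards [hUo.mem_nhds hp] with p' hp'
    exact hΦ₁v v p' hp'
  -- C² of Φ on U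
  have hdiffΦ : DifferentiableOn ℝ Φ U := fun p hp => (hA p hp).1.differentiableAt.differentiableWithinAt
  have hfdΦ : ∀ p ∈ U, fderiv ℝ Φ p = Φ₁ p := fun p hp => (hA p hp).1.fderiv
  have hΦ₁C1 : ContDiffOn ℝ 1 Φ₁ U := by
    refine contDiffOn_clm_apply.mpr fun v => ?_
    rw [show (1 : WithTop ℕ∞) = 0 + 1 from rfl, contDiffOn_succ_iff_fderiv_of_isOpen hUo]
    refine ⟨fun p hp => (hCv v p hp).differentiableAt.differentiableWithinAt, by simp, ?_⟩
    rw [contDiffOn_zero]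
    have e : EqOn (fderiv ℝ (fun p => Φ₁ p v)) (Φ₂ v) U := fun p hp => (hCv v p hp).fderiv
    exact (continuousOn_of_forall_continuousAt fun p hp => (hBv v p hp).2.2).congr e
  have hΦC2 : ContDiffOn ℝ 2 Φ U := by
    rw [show (2 : WithTop ℕ∞) = 1 + 1 from rfl, contDiffOn_succ_iff_fderiv_of_isOpen hUo]
    exact ⟨hdiffΦ, by simp, hΦ₁C1.congr hfdΦ⟩
  -- IsC2 of L_k f
  have heqU : EqOn ((invariantOperator k f) ∘ ofComplex) Φ U := fun p hp => invariantOperator_ofComplex_eq k hp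
  have hIsC2 : IsC2 (invariantOperator k f) := hΦC2.congr heqU
  refine ⟨hIsC2, fun z => ?_⟩
  -- the Laplacian at z
  have hz : (z : ℂ) ∈ U := z.im_pos
  have hnear : ((invariantOperator k f) ∘ ofComplex : ℂ → ℂ) =ᶠ[𝓝 (z : ℂ)] Φ := by
    filter_upwards [hUo.mem_nhds hz] with p hp using heqU hp
  unfold hypLaplacian
  rw [(laplacian_congr_nhds hnear).self_of_nhds, laplacian_eq_fderiv_fderiv]
  -- second derivatives of Φ along v = 1, I via slices
  have hslice : ∀ v : ℂ, fderiv ℝ (fderiv ℝ Φ) z v v = Φ₂ v z v := by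
    intro v
    refine fderiv_fderiv_apply_eq_of_slice hUo hΦC2 hz (σ₁ := fun t => Φ₁ ((z : ℂ) + (t : ℂ) * v) v) ?_ ?_
    · have hn : ∀ᶠ t : ℝ in 𝓝 0, (z : ℂ) + (t : ℂ) * v ∈ U := by
        have hc : Continuous fun t : ℝ => (z : ℂ) + (t : ℂ) * v := by fun_prop
        have : (z : ℂ) + ((0 : ℝ) : ℂ) * v ∈ U := by simpa using hz
        exact hc.continuousAt.preimage_mem_nhds (hUo.mem_nhds this)
      filter_upwards [hn] with t ht
      have h := (hA _ ht).1.comp_hasDerivAt t (hasDerivAt_line (z : ℂ) v t)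
      simpa [Function.comp_def] using h
    · have h := (hCv v ((z : ℂ) + ((0 : ℝ) : ℂ) * v) (by simpa using z.im_pos)).comp_hasDerivAt (0 : ℝ)
        (hasDerivAt_line (z : ℂ) v 0)
      simpa [Function.comp_def] using h
  rw [hslice 1, hslice Complex.I]
  -- Φ₂ v z v = ∫ f w * D²_v k(u(·, w))
  have hΦ₂v : ∀ v : ℂ, Φ₂ v z v = ∫ w : ℍ, f w * fderiv ℝ (Gv v) ((z : ℂ), (w : ℂ)) (v, 0) := by
    intro v
    simp only [hΦ₂]
    rw [ContinuousLinearMap.integral_apply (hBv v z hz).2.1 v]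
    congr 1 with w
  rw [hΦ₂v 1, hΦ₂v Complex.I, ← integral_add]
  rotate_left
  · exact ((ContinuousLinearMap.apply ℝ ℂ (1 : ℂ)).integrable_comp (hBv 1 z hz).2.1).congr
      (Eventually.of_forall fun w => by simp [pD1_apply])
  · exact ((ContinuousLinearMap.apply ℝ ℂ Complex.I).integrable_comp (hBv Complex.I z hz).2.1).congr
      (Eventually.of_forall fun w => by simp [pD1_apply])
  -- compare with L_{k_Δ} f
  unfold invariantOperator
  rw [← integral_const_mul]
  congr 1 with w
  -- the second derivatives of p ↦ k(u(p, w)) along 1 and I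
  set Jw : ℂ → ℂ := fun p => kJoint k (p, (w : ℂ)) with hJw
  have hJwC2 : ContDiffOn ℝ 2 Jw U := hJ2.comp (contDiffOn_id.prodMk contDiffOn_const) fun p hp => ⟨hp, w.im_pos⟩
  have hsliceJ : ∀ v : ℂ, fderiv ℝ (fderiv ℝ Jw) z v v = fderiv ℝ (Gv v) ((z : ℂ), (w : ℂ)) (v, 0) := by
    intro v
    refine fderiv_fderiv_apply_eq_of_slice hUo hJwC2 hz (σ₁ := fun t => Gv v ((z : ℂ) + (t : ℂ) * v, (w : ℂ))) ?_ ?_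
    · have hn : ∀ᶠ t : ℝ in 𝓝 0, (z : ℂ) + (t : ℂ) * v ∈ U := by
        have hc : Continuous fun t : ℝ => (z : ℂ) + (t : ℂ) * v := by fun_prop
        have : (z : ℂ) + ((0 : ℝ) : ℂ) * v ∈ U := by simpa using hz
        exact hc.continuousAt.preimage_mem_nhds (hUo.mem_nhds this)
      filter_upwards [hn] with t ht
      have h := (hasFDerivAt_left hJ1 ht w.im_pos).comp_hasDerivAt t (hasDerivAt_line (z : ℂ) v t)
      simpa [Function.comp_def, hGv, pD1_apply] using h
    · have h := (hasFDerivAt_left (hGv1 v) (p := (z : ℂ) + ((0 : ℝ) : ℂ) * v) (by simpa using z.im_pos) w.im_pos).comp_hasDerivAt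
        (0 : ℝ) (hasDerivAt_line (z : ℂ) v 0)
      simpa [Function.comp_def, pD1_apply] using h
  -- Δ Jw z = hypLaplacian of the kernel / (Im z)²
  have hLap : Δ Jw z = fderiv ℝ (Gv 1) ((z : ℂ), (w : ℂ)) (1, 0) + fderiv ℝ (Gv Complex.I) ((z : ℂ), (w : ℂ)) (Complex.I, 0) := by
    rw [laplacian_eq_fderiv_fderiv, hsliceJ 1, hsliceJ Complex.I]
  have hker : hypLaplacian (fun z' : ℍ => (k (pointPairInv z' w) : ℂ)) z = ((z.im : ℝ) : ℂ) ^ 2 * Δ Jw z := by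
    unfold hypLaplacian
    congr 1
    refine (laplacian_congr_nhds ?_).self_of_nhds
    filter_upwards [pointPairInv_ofComplex_eventuallyEq w z] with p hp
    simp only [Function.comp_apply, hJw, kJoint_eq, uJoint]
    rw [hp]
    rfl
  have hL18 := hypLaplacian_radial_kernel hk1 hk2 hkc z w
  rw [hker, hLap] at hL18
  calc ((z.im : ℝ) : ℂ) ^ 2 * (f w * fderiv ℝ (Gv 1) ((z : ℂ), (w : ℂ)) (1, 0) +
        f w * fderiv ℝ (Gv Complex.I) ((z : ℂ), (w : ℂ)) (Complex.I, 0))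
      = f w * (((z.im : ℝ) : ℂ) ^ 2 * (fderiv ℝ (Gv 1) ((z : ℂ), (w : ℂ)) (1, 0) +
          fderiv ℝ (Gv Complex.I) ((z : ℂ), (w : ℂ)) (Complex.I, 0))) := by ring
    _ = f w * (kernelLaplacian k' k'' (pointPairInv z w) : ℂ) := by rw [hL18]
    _ = (kernelLaplacian k' k'' (pointPairInv z w) : ℂ) * f w := mul_comm _ _

end Theorem19

/-! ## Consequences: `h_{Δk} = -(1/4 + t²) h_k`, and the regularity criterion (Theorem 1.15 flavour) -/

section Regularity

variable {k k' k'' : ℝ → ℝ}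

/-- Truncation of a profile to `u ≥ 0` (the point-pair invariant is non-negative, so truncation does
not change `L_k` or `h`). [folklore] -/
def truncKernel (g : ℝ → ℝ) (u : ℝ) : ℝ := if 0 ≤ u then g u else 0

/-- `L` only sees the kernel on `u ≥ 0`. [folklore] -/
theorem invariantOperator_truncKernel (g : ℝ → ℝ) (f : ℍ → ℂ) (z : ℍ) :
    invariantOperator (truncKernel g) f z = invariantOperator g f z := by
  unfold invariantOperator truncKernel
  congr 1 with w
  rw [if_pos (pointPairInv_nonneg z w)]

/-- `q` (hence `g` and `h`) only sees the kernel on `u ≥ 0`, for `v ≥ 0`. [folklore] -/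
theorem selbergQ_truncKernel (g : ℝ → ℝ) {v : ℝ} (hv : 0 ≤ v) : selbergQ (truncKernel g) v = selbergQ g v := by
  unfold selbergQ truncKernel
  refine setIntegral_congr_fun measurableSet_Ioi fun u hu => ?_
  have : 0 ≤ u := hv.trans (le_of_lt hu)
  simp only [if_pos this]

/-- `h` only sees the kernel on `u ≥ 0`. [folklore] -/
theorem selbergTransform_truncKernel (g : ℝ → ℝ) (t : ℂ) : selbergTransform (truncKernel g) t = selbergTransform g t := by
  unfold selbergTransform selbergG
  congr 1 with r
  rw [selbergQ_truncKernel g (sq_nonneg _)]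

/-- The derivative of a function vanishing on `[M, ∞)` vanishes on `(M, ∞)`. [folklore] -/
theorem deriv_eq_zero_of_vanish {g g' : ℝ → ℝ} (hg : ∀ u, HasDerivAt g (g' u) u) {M : ℝ} (hM : ∀ u, M ≤ u → g u = 0)
    {u : ℝ} (hu : M < u) : g' u = 0 := by
  have h : g =ᶠ[𝓝 u] fun _ => 0 := by
    filter_upwards [Ioi_mem_nhds hu] with v hv using hM v (le_of_lt hv)
  have h2 : HasDerivAt g 0 u := (hasDerivAt_const u (0 : ℝ)).congr_of_eventuallyEq h
  exact (hg u).unique h2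

/-- For a `C²` test kernel `k` vanishing on `[M, ∞)`, `k_Δ = u(u+1)k'' + (2u+1)k'` vanishes on `(M, ∞)`. [folklore] -/
theorem kernelLaplacian_eq_zero (hk1 : ∀ u, HasDerivAt k (k' u) u) (hk2 : ∀ u, HasDerivAt k' (k'' u) u)
    {M : ℝ} (hM : ∀ u, M ≤ u → k u = 0) {u : ℝ} (hu : M < u) :
    kernelLaplacian k' k'' u = 0 := by
  have h1 : ∀ v, M < v → k' v = 0 := fun v hv => deriv_eq_zero_of_vanish hk1 hM hv
  have h2 : k'' u = 0 := by
    have hM' : ∀ v, (M + (u - M) / 2) ≤ v → k' v = 0 := fun v hv => h1 v (by linarith)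
    exact deriv_eq_zero_of_vanish hk2 hM' (by linarith)
  rw [kernelLaplacian, h1 u hu, h2]; ring

variable (hk : IsTestKernel k) (hk1 : ∀ u, HasDerivAt k (k' u) u) (hk2 : ∀ u, HasDerivAt k' (k'' u) u)
  (hkc : ContDiff ℝ 2 k)
include hk hk1 hk2 hkc

/-- **`k_Δ` (truncated to `u ≥ 0`) is a test kernel** for a `C²` test kernel `k`. [folklore] -/
theorem isTestKernel_truncKernel_kernelLaplacian : IsTestKernel (truncKernel (kernelLaplacian k' k'')) := by
  obtain ⟨hkm, ⟨B, hB⟩, ⟨M, hM0, hM⟩⟩ := id hk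
  have hc' : Continuous k' := continuous_k' hk2
  have hc'' : Continuous k'' := continuous_k'' hk1 hk2 hkc
  have hcL : Continuous (kernelLaplacian k' k'') := by unfold kernelLaplacian; fun_prop
  refine ⟨?_, ?_, ⟨M + 1, by linarith, fun u hu => ?_⟩⟩
  · unfold truncKernel
    exact Measurable.ite measurableSet_Ici hcL.measurable measurable_const
  · -- bounded: continuous on the compact interval [0, M + 1], zero elsewhere
    obtain ⟨C, hC⟩ := (isCompact_Icc (a := (0 : ℝ)) (b := M + 1)).exists_bound_of_continuousOn hcL.continuousOn
    refine ⟨max C 0, fun u => ?_⟩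
    unfold truncKernel
    split_ifs with h0
    · by_cases hu : u ≤ M + 1
      · exact (le_of_eq (Real.norm_eq_abs _).symm).trans ((hC u ⟨h0, hu⟩).trans (le_max_left _ _))
      · rw [kernelLaplacian_eq_zero hk1 hk2 hM (by linarith)]
        simp
    · simp
  · unfold truncKernel
    rw [if_pos (by linarith), kernelLaplacian_eq_zero hk1 hk2 hM (by linarith)]

omit hk hk1 hk2 hkc in
/-- `Δ(c g) = c Δg` for `g ∈ C²`. [folklore] -/
theorem hypLaplacian_const_mul' {g : ℍ → ℂ} (hg : IsC2 g) (c : ℂ) (z : ℍ) :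
    hypLaplacian (fun w => c * g w) z = c * hypLaplacian g z := by
  unfold hypLaplacian
  have e : ((fun w => c * g w) ∘ ofComplex : ℂ → ℂ) = c • (g ∘ ofComplex) := by
    funext p; simp [smul_eq_mul]
  have h2 : ContDiffAt ℝ 2 (g ∘ ofComplex) (z : ℂ) := hg.contDiffAt (isOpen_upperHalfPlaneSet.mem_nhds z.im_pos)
  rw [e, InnerProductSpace.laplacian_smul c h2]
  simp only [smul_eq_mul]
  ring

/-- **The transform of `k_Δ`**: `h_{k_Δ}(t) = -(1/4 + t²) h_k(t)` — the invariant integral operator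
`L_{k_Δ} = Δ ∘ L_k` acts on `y^s` by `Δ (h(t) y^s) = -s(1-s) h(t) y^s` (Theorem 1.9 with Theorem 1.16
on `y^s`). [cite: Iwaniec2002, Thm 1.9 & Thm 1.16, PDF pp. 21, 24] -/
theorem selbergTransform_kernelLaplacian (t : ℂ) :
    selbergTransform (kernelLaplacian k' k'') t = -(1 / 4 + t ^ 2) * selbergTransform k t := by
  set s : ℂ := 1 / 2 + Complex.I * t with hs
  set ys : ℍ → ℂ := fun w => ((w.im : ℝ) : ℂ) ^ s with hys
  have hysC2 : IsC2 ys := isC2_im_cpow s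
  have hysli : LocallyIntegrable ys := hysC2.continuous.locallyIntegrable
  -- Theorem 1.9 for f = y^s at z = i
  have h19 := (isC2_invariantOperator_and_hypLaplacian hkc hk hk1 hk2 hysli).2 UpperHalfPlane.I
  -- L_k y^s = h(t) y^s as functions
  have hL : invariantOperator k ys = fun z => selbergTransform k t * ys z := funext fun z => invariantOperator_im_cpow hk t z
  rw [hL, hypLaplacian_const_mul' hysC2] at h19
  -- Δ y^s at i
  have heig : hypLaplacian ys UpperHalfPlane.I = -(1 / 4 + t ^ 2) := by
    have h := hypLaplacian_im_cpow s UpperHalfPlane.I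
    have e : s * (1 - s) = 1 / 4 + t ^ 2 := by rw [hs]; ring_nf; rw [Complex.I_sq]; ring
    rw [show (fun w : ℍ => ((w.im : ℂ)) ^ s) = ys from rfl, e] at h
    simp only [UpperHalfPlane.I_im, Complex.ofReal_one, Complex.one_cpow, mul_one] at h
    linear_combination h
  rw [heig] at h19
  -- the right side: L_{k_Δ} y^s (i) = h_{k_Δ}(t) (through the truncated kernel, a test kernel)
  have hR : invariantOperator (kernelLaplacian k' k'') ys UpperHalfPlane.I = selbergTransform (kernelLaplacian k' k'') t := by
    rw [← invariantOperator_truncKernel, invariantOperator_im_cpow (isTestKernel_truncKernel_kernelLaplacian hk hk1 hk2 hkc) t,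
      selbergTransform_truncKernel]
    simp [UpperHalfPlane.I_im]
  rw [hR] at h19
  linear_combination -h19

end Regularity

/-! ## A smooth non-negative test kernel with `h(t) ≠ 0` -/

section Bump

/-- For a non-negative test kernel supported in `[0, δ]`, `0 < δ ≤ 1/64`, and `|s| · 32√δ ≤ 1`
(`s = 1/2 + it`): `|h(t) - 4π∫k| ≤ ½ · 4π∫k` (as in the proof of Proposition 7.2, p. 73, for the
characteristic function). [cite: Iwaniec2002, proof of Prop. 7.2, PDF p. 73] -/
theorem norm_selbergTransform_sub_le {k : ℝ → ℝ} (hk : IsTestKernel k) (hk0 : ∀ u, 0 ≤ k u) {δ : ℝ}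
    (hδ : 0 < δ) (hδ' : δ ≤ 1 / 64) (hkδ : ∀ u, δ < u → k u = 0) (t : ℂ)
    (hs : ‖(1 / 2 : ℂ) + Complex.I * t‖ * (32 * Real.sqrt δ) ≤ 1) :
    ‖selbergTransform k t - ((4 * π * ∫ u in Ioi 0, k u : ℝ) : ℂ)‖ ≤ (1 / 2) * (4 * π * ∫ u in Ioi 0, k u) := by
  set s : ℂ := (1 / 2 : ℂ) + Complex.I * t with hsdef
  have h1 : selbergTransform k t = ∫ w : ℍ, (k (pointPairInv UpperHalfPlane.I w) : ℂ) * ((w.im : ℝ) : ℂ) ^ s :=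
    selbergTransform_eq_integral hk t
  have h2 : ∫ w : ℍ, (k (pointPairInv UpperHalfPlane.I w) : ℂ) = ((4 * π * ∫ u in Ioi 0, k u : ℝ) : ℂ) :=
    integral_kernel_eq hk UpperHalfPlane.I
  have hint1 : Integrable fun w : ℍ => (k (pointPairInv UpperHalfPlane.I w) : ℂ) * ((w.im : ℝ) : ℂ) ^ s :=
    integrable_kernel_mul_of_continuous hk (continuous_im_cpow s) UpperHalfPlane.I
  have hint2 : Integrable fun w : ℍ => (k (pointPairInv UpperHalfPlane.I w) : ℂ) := by
    have := integrable_kernel_mul_of_continuous hk (continuous_const (y := (1 : ℂ))) UpperHalfPlane.I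
    simpa using this
  have hdiff : selbergTransform k t - ((4 * π * ∫ u in Ioi 0, k u : ℝ) : ℂ) =
      ∫ w : ℍ, (k (pointPairInv UpperHalfPlane.I w) : ℂ) * (((w.im : ℝ) : ℂ) ^ s - 1) := by
    rw [h1, ← h2, ← integral_sub hint1 hint2]
    congr 1 with w; ring
  have hpt : ∀ w : ℍ, ‖(k (pointPairInv UpperHalfPlane.I w) : ℂ) * (((w.im : ℝ) : ℂ) ^ s - 1)‖ ≤
      (1 / 2) * k (pointPairInv UpperHalfPlane.I w) := by
    intro w
    by_cases hw : pointPairInv UpperHalfPlane.I w ≤ δ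
    · rw [norm_mul, Complex.norm_real, Real.norm_eq_abs, abs_of_nonneg (hk0 _)]
      have hy := abs_im_sub_one_le hδ.le (hδ'.trans (by norm_num)) hw
      have hη2 : 4 * Real.sqrt δ ≤ 1 / 2 := by
        have : Real.sqrt δ ≤ Real.sqrt (1 / 64) := Real.sqrt_le_sqrt hδ'
        rw [show (1 / 64 : ℝ) = (1 / 8) ^ 2 by norm_num, Real.sqrt_sq (by norm_num)] at this
        linarith
      have hsη : ‖s‖ * (4 * Real.sqrt δ) ≤ 1 / 4 := by nlinarith [norm_nonneg s, Real.sqrt_nonneg δ]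
      have := norm_cpow_sub_one_le w.im_pos hy hη2 hsη
      have hk0' := hk0 (pointPairInv UpperHalfPlane.I w)
      nlinarith [norm_nonneg s, norm_nonneg (((w.im : ℝ) : ℂ) ^ s - 1), Real.sqrt_nonneg δ]
    · rw [hkδ _ (not_le.mp hw)]
      simp
  rw [hdiff]
  calc ‖∫ w : ℍ, (k (pointPairInv UpperHalfPlane.I w) : ℂ) * (((w.im : ℝ) : ℂ) ^ s - 1)‖
      ≤ ∫ w : ℍ, (1 / 2) * k (pointPairInv UpperHalfPlane.I w) := by
        refine norm_integral_le_of_norm_le ?_ (Eventually.of_forall hpt)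
        have : Integrable fun w : ℍ => k (pointPairInv UpperHalfPlane.I w) := by
          have h3 := hint2.re
          refine h3.congr (Eventually.of_forall fun w => ?_)
          simp
        exact this.const_mul _
    _ = (1 / 2) * (4 * π * ∫ u in Ioi 0, k u) := by rw [integral_const_mul, integral_kernel_eq_real hk]

/-- **A smooth test kernel with `h(t) ≠ 0`** (for every `t ∈ ℂ`): a smooth bump `0 ≤ k ≤ 1`
supported in `[-δ, δ]`, equal to `1` on `[-δ/2, δ/2]`, with `δ` small in terms of `|s|`.
[folklore] -/
theorem exists_smooth_testKernel (t : ℂ) :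
    ∃ k : ℝ → ℝ, IsTestKernel k ∧ ContDiff ℝ 2 k ∧ selbergTransform k t ≠ 0 := by
  set s : ℂ := (1 / 2 : ℂ) + Complex.I * t with hsdef
  set δ : ℝ := min (1 / 64) ((32 * (‖s‖ + 1))⁻¹ ^ 2) with hδdef
  have hδ0 : 0 < δ := by rw [hδdef]; exact lt_min (by norm_num) (by positivity)
  have hδ1 : δ ≤ 1 / 64 := min_le_left _ _
  have hδ2 : Real.sqrt δ ≤ (32 * (‖s‖ + 1))⁻¹ := by
    have : δ ≤ (32 * (‖s‖ + 1))⁻¹ ^ 2 := min_le_right _ _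
    calc Real.sqrt δ ≤ Real.sqrt ((32 * (‖s‖ + 1))⁻¹ ^ 2) := Real.sqrt_le_sqrt this
      _ = (32 * (‖s‖ + 1))⁻¹ := Real.sqrt_sq (by positivity)
  have hs : ‖s‖ * (32 * Real.sqrt δ) ≤ 1 := by
    have h1 : ‖s‖ * (32 * Real.sqrt δ) ≤ ‖s‖ * (32 * (32 * (‖s‖ + 1))⁻¹) := by gcongr
    have h2 : ‖s‖ * (32 * (32 * (‖s‖ + 1))⁻¹) = ‖s‖ / (‖s‖ + 1) := by field_simp
    have h3 : ‖s‖ / (‖s‖ + 1) ≤ 1 := by rw [div_le_one (by positivity)]; linarith [norm_nonneg s]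
    linarith
  -- the bump
  let χ : ContDiffBump (0 : ℝ) := ⟨δ / 2, δ, by positivity, by linarith⟩
  refine ⟨χ, ?_, χ.contDiff, ?_⟩
  · refine ⟨χ.continuous.measurable, ⟨1, fun u => ?_⟩, ⟨δ, hδ0.le, fun u hu => ?_⟩⟩
    · rw [abs_of_nonneg χ.nonneg]; exact χ.le_one
    · exact χ.zero_of_le_dist (by rw [Real.dist_eq, sub_zero, abs_of_nonneg (hδ0.le.trans hu)]; exact hu)
  · have hk : IsTestKernel χ := ⟨χ.continuous.measurable, ⟨1, fun u => by rw [abs_of_nonneg χ.nonneg]; exact χ.le_one⟩,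
      ⟨δ, hδ0.le, fun u hu => χ.zero_of_le_dist (by rw [Real.dist_eq, sub_zero, abs_of_nonneg (hδ0.le.trans hu)]; exact hu)⟩⟩
    have hkδ : ∀ u, δ < u → (χ : ℝ → ℝ) u = 0 := fun u hu =>
      χ.zero_of_le_dist (by rw [Real.dist_eq, sub_zero, abs_of_nonneg (hδ0.le.trans hu.le)]; exact hu.le)
    have hest := norm_selbergTransform_sub_le hk (fun u => χ.nonneg) hδ0 hδ1 hkδ t hs
    -- ∫_0^∞ χ ≥ δ/2 > 0
    have hI : δ / 2 ≤ ∫ u in Ioi 0, (χ : ℝ → ℝ) u := by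
      have hint : Integrable (χ : ℝ → ℝ) := χ.continuous.integrable_of_hasCompactSupport χ.hasCompactSupport
      have hsub : Set.Ioc 0 (δ / 2) ⊆ Ioi 0 := fun u hu => hu.1
      calc δ / 2 = ∫ u in Set.Ioc 0 (δ / 2), (1 : ℝ) := by
            rw [setIntegral_const]; simp [Real.volume_real_Ioc_of_le (by positivity : (0:ℝ) ≤ δ / 2)]
        _ = ∫ u in Set.Ioc 0 (δ / 2), (χ : ℝ → ℝ) u := by
            refine setIntegral_congr_fun measurableSet_Ioc fun u hu => ?_
            exact (χ.one_of_mem_closedBall (by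
              rw [Metric.mem_closedBall, Real.dist_eq, sub_zero, abs_of_nonneg hu.1.le]; exact hu.2)).symm
        _ ≤ ∫ u in Ioi 0, (χ : ℝ → ℝ) u :=
            setIntegral_mono_set hint.integrableOn (Eventually.of_forall fun u => χ.nonneg) (Eventually.of_forall hsub)
    have hIpos : 0 < ∫ u in Ioi 0, (χ : ℝ → ℝ) u := by linarith
    intro h0
    rw [h0, zero_sub, norm_neg, Complex.norm_real, Real.norm_eq_abs,
      abs_of_nonneg (by positivity : (0:ℝ) ≤ 4 * π * ∫ u in Ioi 0, (χ : ℝ → ℝ) u)] at hest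
    nlinarith [Real.pi_pos, Real.pi_gt_three]


/-! ## The regularity criterion -/

/-- `C²` is preserved by constant multiples. [folklore] -/
theorem IsC2.const_mul {g : ℍ → ℂ} (hg : IsC2 g) (c : ℂ) : IsC2 (fun w => c * g w) := by
  have e : ((fun w => c * g w) ∘ ofComplex : ℂ → ℂ) = c • (g ∘ ofComplex) := by
    funext p; simp [smul_eq_mul]
  unfold IsC2
  rw [e]
  exact hg.const_smul c

/-- **Regularity of eigenfunctions of the invariant integral operators** (Theorems 1.9, 1.15 and
1.16 combined): a locally integrable `f : ℍ → ℂ` with `L_k f = h_k(t) f` for every test kernel `k`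
is of class `C²` and satisfies `(Δ + 1/4 + t²) f = 0`. (Pick a smooth `k₀` with `h_{k₀}(t) ≠ 0`:
`f = h_{k₀}(t)⁻¹ L_{k₀} f ∈ C²` and `Δ f = h_{k₀}⁻¹ L_{(k₀)_Δ} f = h_{k₀}⁻¹ h_{(k₀)_Δ}(t) f = -(1/4+t²) f`.)
This is the regularity input for Eisenstein series and Maass forms constructed through integral
operators. [cite: Iwaniec2002, Thms 1.9, 1.15 & 1.16, PDF pp. 21, 23–24] -/
theorem isC2_and_eigen_of_invariantOperator {f : ℍ → ℂ} (hf : LocallyIntegrable f) (t : ℂ)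
    (h : ∀ k : ℝ → ℝ, IsTestKernel k → ∀ z, invariantOperator k f z = selbergTransform k t * f z) :
    IsC2 f ∧ ∀ z, hypLaplacian f z + (1 / 4 + t ^ 2) * f z = 0 := by
  obtain ⟨k₀, hk₀, hk₀c, hh₀⟩ := exists_smooth_testKernel t
  set h₀ : ℂ := selbergTransform k₀ t with hh₀def
  -- the derivatives of k₀
  have hk1 : ∀ u, HasDerivAt k₀ (deriv k₀ u) u := fun u => ((hk₀c.differentiable (by norm_num)) u).hasDerivAt
  have hd1 : ContDiff ℝ 1 (deriv k₀) := (contDiff_succ_iff_deriv.mp (show ContDiff ℝ (1 + 1) k₀ from hk₀c)).2.2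
  have hk2 : ∀ u, HasDerivAt (deriv k₀) (deriv (deriv k₀) u) u := fun u => ((hd1.differentiable one_ne_zero) u).hasDerivAt
  -- f = h₀⁻¹ L_{k₀} f
  have hfeq : f = fun z => h₀⁻¹ * invariantOperator k₀ f z := by
    funext z
    rw [h k₀ hk₀ z, ← hh₀def, ← mul_assoc, inv_mul_cancel₀ hh₀, one_mul]
  obtain ⟨hC2L, hLap⟩ := isC2_invariantOperator_and_hypLaplacian hk₀c hk₀ hk1 hk2 hf
  have hC2f : IsC2 f := by rw [hfeq]; exact hC2L.const_mul h₀⁻¹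
  refine ⟨hC2f, fun z => ?_⟩
  have e1 : hypLaplacian f z = h₀⁻¹ * hypLaplacian (invariantOperator k₀ f) z := by
    conv_lhs => rw [hfeq]
    exact hypLaplacian_const_mul' hC2L h₀⁻¹ z
  rw [e1, hLap z, ← invariantOperator_truncKernel,
    h _ (isTestKernel_truncKernel_kernelLaplacian hk₀ hk1 hk2 hk₀c) z, selbergTransform_truncKernel,
    selbergTransform_kernelLaplacian hk₀ hk1 hk2 hk₀c t, ← hh₀def]
  field_simp
  ring

end Bump

end Literature.NumberTheory.Automorphic
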